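import Summits.PneNP.PneNP.Theorems.ExpanderLinearGeneratorsMoorePhaseTwoCases

/-!
# A Moore-type bound for `(r, 6)`-boundary expanders with `8`-point scopes, V: phase two
(route ExpanderLinearGenerators, item stmt-PneNP-11442, helper file)

The three ROW collisions of the exploration tree grown from a row of a cycle `Z`
(`collision_rowZ`, `collision_row_old`, `collision_row_new`; the point collisions are in file IV),
and PHASE TWO itself: since every collision is contradictory, the labels of that tree stay
injective and off `Z` at every level `n` with `|Z| + 4n + 10 ≤ r` (`phaseTwo_step`), hence the row
labels are injective up to level `N` whenever `|Z| + 4N + 6 ≤ r` (`phaseTwo`).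
-/

namespace Summit.PneNP.PneNP.Theorems

set_option linter.dupNamespace false -- `Summit.PneNP.PneNP.…`: summit = sub-problem (D-0017)

namespace MooreBound

open Finset SimpleGraph Literature.Computability.MetaComplexity

variable {ι : Type*} {S : ι → Finset ℕ} {F : Finset ι} {G : SimpleGraph (ι ⊕ ℕ)}

section PhaseTwo

variable (hG : ∀ x y, G.Adj x y ↔ ∃ a v, a ∈ F ∧ v ∈ S a ∧
  ((x = Sum.inl a ∧ y = Sum.inr v) ∨ (x = Sum.inr v ∧ y = Sum.inl a)))
variable {ρ : List Bool → ι} {φ : List Bool → ℕ}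
variable (H1 : ∀ w, ρ w ∈ F)
variable (H2 : ∀ c w, φ (c :: w) ∈ S (ρ w) ∧ φ (c :: w) ∈ S (ρ (c :: w)))
variable (H3 : ∀ c w, ρ (c :: w) ≠ ρ w)
variable (H4 : ∀ w, φ (false :: w) ≠ φ (true :: w))
variable (H5 : ∀ c c' w, φ (c :: c' :: w) ≠ φ (c' :: w))
variable {Z : G.Walk (Sum.inl (ρ [])) (Sum.inl (ρ []))} (hZ : Z.IsCycle)
variable (H6 : ∀ c, Sum.inr (φ [c]) ≠ Z.snd ∧ Sum.inr (φ [c]) ≠ Z.penultimate)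
variable [DecidableEq ι]
variable (hS8 : ∀ a ∈ F, (S a).card ≤ 8) {r : ℝ} (hexp : IsBoundaryExpander S r 6)

include hG H1 H2 H3 H5 hZ H6 hS8 hexp

/-! #### The three row collisions -/

/-- **A new row on `Z`** (its entry point being off `Z`). [folklore] -/
theorem collision_rowZ {n : ℕ} (hr : ((Z.length + 4 * n + 10 : ℕ) : ℝ) ≤ r)
    (hIR : ∀ u u' : List Bool, u.length ≤ n → u'.length ≤ n → ρ u = ρ u' → u = u')
    {w : List Bool} (hw : w.length ≤ n) (c : Bool)
    (haZ : (Sum.inl (ρ (c :: w)) : ι ⊕ ℕ) ∈ Z.support)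
    (hyZ : (Sum.inr (φ (c :: w)) : ι ⊕ ℕ) ∉ Z.support) : False := by
  obtain ⟨P, hP, -, hPe, hPl⟩ := exists_treePath hG H1 H2 (ρ := ρ) (φ := φ) w
  have hne5 : ∀ (c₀ : Bool) {u : List Bool}, u ≠ [] → φ (c₀ :: u) ≠ φ u := fun c₀ u hu => by
    obtain ⟨c', u', rfl⟩ := List.exists_cons_of_ne_nil hu
    exact H5 c₀ c' u'
  have hwy := adj_parent hG H1 H2 c w
  have hya := adj_child hG H1 H2 c w
  set C := Z.toSubgraph ⊔ P.toSubgraph ⊔ G.subgraphOfAdj hwy ⊔ G.subgraphOfAdj hya with hC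
  have hZC : Z.toSubgraph ≤ C := le_sup_left.trans (le_sup_left.trans le_sup_left)
  have hPC : P.toSubgraph ≤ C := le_sup_right.trans (le_sup_left.trans le_sup_left)
  have hCwy : C.Adj (Sum.inl (ρ w)) (Sum.inr (φ (c :: w))) :=
    (le_sup_right.trans le_sup_left : G.subgraphOfAdj hwy ≤ C).2 (subgraphOfAdj_adj_self hwy)
  have hCya : C.Adj (Sum.inr (φ (c :: w))) (Sum.inl (ρ (c :: w))) :=
    (le_sup_right : G.subgraphOfAdj hya ≤ C).2 (subgraphOfAdj_adj_self hya)
  have hendw : w ≠ [] → ∃ t, C.Adj (Sum.inl (ρ w)) t ∧ t ≠ Sum.inr (φ w) :=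
    fun hwne => ⟨_, hCwy, fun h => hne5 c hwne (Sum.inr_injective h)⟩
  have hρ : (Sum.inl (ρ w) : ι ⊕ ℕ) ≠ Sum.inl (ρ (c :: w)) := fun h =>
    H3 c w (Sum.inl_injective h).symm
  have h3 : 3 ≤ (C.neighborSet (Sum.inl (ρ []))).ncard := by
    rcases eq_or_ne w [] with rfl | hwne
    · exact three_le_of_adj_notMem hG hZ hZC hCwy hyZ
    · exact three_le_of_treePath hG hZ H6 hZC hIR hw hwne hPe hPC
  refine config_contra hG hS8 hexp C ?_ (b := ρ []) h3
    (L := Z.support ++ P.support ++ [] ++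
      [Sum.inl (ρ w), Sum.inr (φ (c :: w)), Sum.inr (φ (c :: w)), Sum.inl (ρ (c :: w))]) ?_
    (length_bound_aux (Z := Z) P.support [] _ (by rw [Walk.length_support]; omega) (by simp)
      (by simp) hr)
  · intro x hx
    simp only [hC, Subgraph.verts_sup, Set.mem_union, Walk.verts_toSubgraph, Set.mem_setOf_eq,
      subgraphOfAdj_verts, Set.mem_insert_iff, Set.mem_singleton_iff] at hx
    rcases hx with ((hx | hx) | rfl | rfl) | rfl | rfl
    · exact two_le_ncard_of_cycle hG hZ hZC hx
    · exact two_le_of_mem_treePath hG hZ hZC hIR hw hP hPe hPC hendw hx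
    · exact two_le_of_mem_treePath hG hZ hZC hIR hw hP hPe hPC hendw P.end_mem_support
    · exact two_le_ncard_neighborSet hG hCwy.symm hCya hρ
    · exact two_le_ncard_neighborSet hG hCwy.symm hCya hρ
    · exact two_le_ncard_of_cycle hG hZ hZC haZ
  · intro x hx
    simp only [hC, Subgraph.verts_sup, Set.mem_union, Walk.verts_toSubgraph, Set.mem_setOf_eq,
      subgraphOfAdj_verts, Set.mem_insert_iff, Set.mem_singleton_iff] at hx
    simp only [List.append_nil, List.mem_append, List.mem_cons, List.not_mem_nil, or_false]
    rcases hx with (((hx | hx) | hx | hx) | hx | hx) <;> simp only [hx, true_or, or_true]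

omit H3 in
/-- **A new row equal to a processed one** (`ρ (c :: w) = ρ z`, `z ≠ []`, `z ≠ w`, with the new
entry point different from `φ z`). [folklore] -/
theorem collision_row_old {n : ℕ} (hr : ((Z.length + 4 * n + 10 : ℕ) : ℝ) ≤ r)
    (hIR : ∀ u u' : List Bool, u.length ≤ n → u'.length ≤ n → ρ u = ρ u' → u = u')
    {w z : List Bool} (hw : w.length ≤ n) (hz : z.length ≤ n) (hzne : z ≠ []) (hzw : z ≠ w)
    (c : Bool) (heq : ρ (c :: w) = ρ z) (hyz : φ (c :: w) ≠ φ z) : False := by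
  obtain ⟨P, hP, -, hPe, hPl⟩ := exists_treePath hG H1 H2 (ρ := ρ) (φ := φ) w
  have hne5 : ∀ (c₀ : Bool) {u : List Bool}, u ≠ [] → φ (c₀ :: u) ≠ φ u := fun c₀ u hu => by
    obtain ⟨c', u', rfl⟩ := List.exists_cons_of_ne_nil hu
    exact H5 c₀ c' u'
  obtain ⟨Q, hQ, -, hQe, hQl⟩ := exists_treePath hG H1 H2 (ρ := ρ) (φ := φ) z
  have hwy := adj_parent hG H1 H2 c w
  have hya : G.Adj (Sum.inr (φ (c :: w))) (Sum.inl (ρ z)) := by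
    rw [← heq]; exact adj_child hG H1 H2 c w
  set C := Z.toSubgraph ⊔ P.toSubgraph ⊔ Q.toSubgraph ⊔ G.subgraphOfAdj hwy ⊔
    G.subgraphOfAdj hya with hC
  have hZC : Z.toSubgraph ≤ C := le_sup_left.trans (le_sup_left.trans (le_sup_left.trans le_sup_left))
  have hPC : P.toSubgraph ≤ C := le_sup_right.trans (le_sup_left.trans (le_sup_left.trans le_sup_left))
  have hQC : Q.toSubgraph ≤ C := le_sup_right.trans (le_sup_left.trans le_sup_left)
  have hCwy : C.Adj (Sum.inl (ρ w)) (Sum.inr (φ (c :: w))) :=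
    (le_sup_right.trans le_sup_left : G.subgraphOfAdj hwy ≤ C).2 (subgraphOfAdj_adj_self hwy)
  have hCyz : C.Adj (Sum.inr (φ (c :: w))) (Sum.inl (ρ z)) :=
    (le_sup_right : G.subgraphOfAdj hya ≤ C).2 (subgraphOfAdj_adj_self hya)
  have hendw : w ≠ [] → ∃ t, C.Adj (Sum.inl (ρ w)) t ∧ t ≠ Sum.inr (φ w) :=
    fun hwne => ⟨_, hCwy, fun h => hne5 c hwne (Sum.inr_injective h)⟩
  have hendz : z ≠ [] → ∃ t, C.Adj (Sum.inl (ρ z)) t ∧ t ≠ Sum.inr (φ z) :=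
    fun _ => ⟨_, hCyz.symm, fun h => hyz (Sum.inr_injective h)⟩
  have hρ : (Sum.inl (ρ w) : ι ⊕ ℕ) ≠ Sum.inl (ρ z) := fun h =>
    hzw (hIR _ _ hz hw (Sum.inl_injective h).symm)
  refine config_contra hG hS8 hexp C ?_ (b := ρ [])
    (three_le_of_treePath hG hZ H6 hZC hIR hz hzne hQe hQC)
    (L := Z.support ++ P.support ++ Q.support ++
      [Sum.inl (ρ w), Sum.inr (φ (c :: w)), Sum.inr (φ (c :: w)), Sum.inl (ρ z)]) ?_
    (length_bound_aux (Z := Z) P.support Q.support _ (by rw [Walk.length_support]; omega)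
      (by rw [Walk.length_support]; omega) (by simp) hr)
  · intro x hx
    simp only [hC, Subgraph.verts_sup, Set.mem_union, Walk.verts_toSubgraph, Set.mem_setOf_eq,
      subgraphOfAdj_verts, Set.mem_insert_iff, Set.mem_singleton_iff] at hx
    rcases hx with (((hx | hx) | hx) | rfl | rfl) | rfl | rfl
    · exact two_le_ncard_of_cycle hG hZ hZC hx
    · exact two_le_of_mem_treePath hG hZ hZC hIR hw hP hPe hPC hendw hx
    · exact two_le_of_mem_treePath hG hZ hZC hIR hz hQ hQe hQC hendz hx
    · exact two_le_of_mem_treePath hG hZ hZC hIR hw hP hPe hPC hendw P.end_mem_support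
    · exact two_le_ncard_neighborSet hG hCwy.symm hCyz hρ
    · exact two_le_ncard_neighborSet hG hCwy.symm hCyz hρ
    · exact two_le_of_mem_treePath hG hZ hZC hIR hz hQ hQe hQC hendz Q.end_mem_support
  · intro x hx
    simp only [hC, Subgraph.verts_sup, Set.mem_union, Walk.verts_toSubgraph, Set.mem_setOf_eq,
      subgraphOfAdj_verts, Set.mem_insert_iff, Set.mem_singleton_iff] at hx
    simp only [List.mem_append, List.mem_cons, List.not_mem_nil, or_false]
    rcases hx with ((((hx | hx) | hx) | hx | hx) | hx | hx) <;> simp only [hx, true_or, or_true]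

/-- **Two new rows coincide** (`ρ (c :: w) = ρ (c' :: w')` with distinct new entry points, the
first off `Z`). [folklore] -/
theorem collision_row_new {n : ℕ} (hr : ((Z.length + 4 * n + 10 : ℕ) : ℝ) ≤ r)
    (hIR : ∀ u u' : List Bool, u.length ≤ n → u'.length ≤ n → ρ u = ρ u' → u = u')
    {w w' : List Bool} (hw : w.length ≤ n) (hw' : w'.length ≤ n) (c c' : Bool)
    (heq : ρ (c :: w) = ρ (c' :: w')) (hyy : φ (c :: w) ≠ φ (c' :: w'))
    (hyZ : (Sum.inr (φ (c :: w)) : ι ⊕ ℕ) ∉ Z.support) : False := by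
  obtain ⟨P, hP, -, hPe, hPl⟩ := exists_treePath hG H1 H2 (ρ := ρ) (φ := φ) w
  have hne5 : ∀ (c₀ : Bool) {u : List Bool}, u ≠ [] → φ (c₀ :: u) ≠ φ u := fun c₀ u hu => by
    obtain ⟨c', u', rfl⟩ := List.exists_cons_of_ne_nil hu
    exact H5 c₀ c' u'
  obtain ⟨Q, hQ, -, hQe, hQl⟩ := exists_treePath hG H1 H2 (ρ := ρ) (φ := φ) w'
  have hwy := adj_parent hG H1 H2 c w
  have hya := adj_child hG H1 H2 c w
  have hay' : G.Adj (Sum.inl (ρ (c :: w))) (Sum.inr (φ (c' :: w'))) := by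
    rw [heq]; exact (adj_child hG H1 H2 c' w').symm
  have hy'w' : G.Adj (Sum.inr (φ (c' :: w'))) (Sum.inl (ρ w')) := (adj_parent hG H1 H2 c' w').symm
  set C := Z.toSubgraph ⊔ P.toSubgraph ⊔ Q.toSubgraph ⊔ G.subgraphOfAdj hwy ⊔
    G.subgraphOfAdj hya ⊔ G.subgraphOfAdj hay' ⊔ G.subgraphOfAdj hy'w' with hC
  have hZC : Z.toSubgraph ≤ C := le_sup_left.trans (le_sup_left.trans (le_sup_left.trans
    (le_sup_left.trans (le_sup_left.trans le_sup_left))))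
  have hPC : P.toSubgraph ≤ C := le_sup_right.trans (le_sup_left.trans (le_sup_left.trans
    (le_sup_left.trans (le_sup_left.trans le_sup_left))))
  have hQC : Q.toSubgraph ≤ C :=
    le_sup_right.trans (le_sup_left.trans (le_sup_left.trans (le_sup_left.trans le_sup_left)))
  have hCwy : C.Adj (Sum.inl (ρ w)) (Sum.inr (φ (c :: w))) :=
    (le_sup_right.trans (le_sup_left.trans (le_sup_left.trans le_sup_left)) :
      G.subgraphOfAdj hwy ≤ C).2 (subgraphOfAdj_adj_self hwy)
  have hCya : C.Adj (Sum.inr (φ (c :: w))) (Sum.inl (ρ (c :: w))) :=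
    (le_sup_right.trans (le_sup_left.trans le_sup_left) : G.subgraphOfAdj hya ≤ C).2
      (subgraphOfAdj_adj_self hya)
  have hCay' : C.Adj (Sum.inl (ρ (c :: w))) (Sum.inr (φ (c' :: w'))) :=
    (le_sup_right.trans le_sup_left : G.subgraphOfAdj hay' ≤ C).2 (subgraphOfAdj_adj_self hay')
  have hCy'w' : C.Adj (Sum.inr (φ (c' :: w'))) (Sum.inl (ρ w')) :=
    (le_sup_right : G.subgraphOfAdj hy'w' ≤ C).2 (subgraphOfAdj_adj_self hy'w')
  have hendw : w ≠ [] → ∃ t, C.Adj (Sum.inl (ρ w)) t ∧ t ≠ Sum.inr (φ w) :=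
    fun hwne => ⟨_, hCwy, fun h => hne5 c hwne (Sum.inr_injective h)⟩
  have hendw' : w' ≠ [] → ∃ t, C.Adj (Sum.inl (ρ w')) t ∧ t ≠ Sum.inr (φ w') :=
    fun hwne => ⟨_, hCy'w'.symm, fun h => hne5 c' hwne (Sum.inr_injective h)⟩
  have hρ : (Sum.inl (ρ w) : ι ⊕ ℕ) ≠ Sum.inl (ρ (c :: w)) := fun h =>
    H3 c w (Sum.inl_injective h).symm
  have hρ' : (Sum.inl (ρ (c :: w)) : ι ⊕ ℕ) ≠ Sum.inl (ρ w') := fun h =>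
    H3 c' w' (heq.symm.trans (Sum.inl_injective h))
  have hyy' : (Sum.inr (φ (c :: w)) : ι ⊕ ℕ) ≠ Sum.inr (φ (c' :: w')) := fun h =>
    hyy (Sum.inr_injective h)
  have h3 : 3 ≤ (C.neighborSet (Sum.inl (ρ []))).ncard := by
    rcases eq_or_ne w [] with rfl | hwne
    · exact three_le_of_adj_notMem hG hZ hZC hCwy hyZ
    · exact three_le_of_treePath hG hZ H6 hZC hIR hw hwne hPe hPC
  refine config_contra hG hS8 hexp C ?_ (b := ρ []) h3
    (L := Z.support ++ P.support ++ Q.support ++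
      [Sum.inl (ρ w), Sum.inr (φ (c :: w)), Sum.inr (φ (c :: w)), Sum.inl (ρ (c :: w)),
        Sum.inr (φ (c' :: w')), Sum.inl (ρ w')]) ?_
    (length_bound_aux (Z := Z) P.support Q.support _ (by rw [Walk.length_support]; omega)
      (by rw [Walk.length_support]; omega) (by simp) hr)
  · intro x hx
    simp only [hC, Subgraph.verts_sup, Set.mem_union, Walk.verts_toSubgraph, Set.mem_setOf_eq,
      subgraphOfAdj_verts, Set.mem_insert_iff, Set.mem_singleton_iff] at hx
    rcases hx with (((((hx | hx) | hx) | rfl | rfl) | rfl | rfl) | rfl | rfl) | rfl | rfl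
    · exact two_le_ncard_of_cycle hG hZ hZC hx
    · exact two_le_of_mem_treePath hG hZ hZC hIR hw hP hPe hPC hendw hx
    · exact two_le_of_mem_treePath hG hZ hZC hIR hw' hQ hQe hQC hendw' hx
    · exact two_le_of_mem_treePath hG hZ hZC hIR hw hP hPe hPC hendw P.end_mem_support
    · exact two_le_ncard_neighborSet hG hCwy.symm hCya hρ
    · exact two_le_ncard_neighborSet hG hCwy.symm hCya hρ
    · exact two_le_ncard_neighborSet hG hCya.symm hCay' hyy'
    · exact two_le_ncard_neighborSet hG hCya.symm hCay' hyy'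
    · exact two_le_ncard_neighborSet hG hCay'.symm hCy'w' hρ'
    · exact two_le_ncard_neighborSet hG hCay'.symm hCy'w' hρ'
    · exact two_le_of_mem_treePath hG hZ hZC hIR hw' hQ hQe hQC hendw' Q.end_mem_support
  · intro x hx
    simp only [hC, Subgraph.verts_sup, Set.mem_union, Walk.verts_toSubgraph, Set.mem_setOf_eq,
      subgraphOfAdj_verts, Set.mem_insert_iff, Set.mem_singleton_iff] at hx
    simp only [List.mem_append, List.mem_cons, List.not_mem_nil, or_false]
    rcases hx with ((((((hx | hx) | hx) | hx | hx) | hx | hx) | hx | hx) | hx | hx) <;> simp only [hx, true_or, or_true]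

/-! #### Phase two -/

include H4 in
/-- **Phase two, one level.** Injectivity of the labels and avoidance of `Z` pass from level `n`
to level `n + 1` as long as `|Z| + 4n + 10 ≤ r`: every way they could fail is one of the six
contradictory collisions. [folklore] -/
theorem phaseTwo_step {n : ℕ} (hr : ((Z.length + 4 * n + 10 : ℕ) : ℝ) ≤ r)
    (hIR : ∀ u u' : List Bool, u.length ≤ n → u'.length ≤ n → ρ u = ρ u' → u = u')
    (hIP : ∀ u u' : List Bool, u ≠ [] → u' ≠ [] → u.length ≤ n → u'.length ≤ n →
      φ u = φ u' → u = u')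
    (hAR : ∀ u : List Bool, u ≠ [] → u.length ≤ n → (Sum.inl (ρ u) : ι ⊕ ℕ) ∉ Z.support)
    (hAP : ∀ u : List Bool, u ≠ [] → u.length ≤ n → (Sum.inr (φ u) : ι ⊕ ℕ) ∉ Z.support) :
    (∀ u u' : List Bool, u.length ≤ n + 1 → u'.length ≤ n + 1 → ρ u = ρ u' → u = u') ∧
    (∀ u u' : List Bool, u ≠ [] → u' ≠ [] → u.length ≤ n + 1 → u'.length ≤ n + 1 →
      φ u = φ u' → u = u') ∧
    (∀ u : List Bool, u ≠ [] → u.length ≤ n + 1 → (Sum.inl (ρ u) : ι ⊕ ℕ) ∉ Z.support) ∧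
    (∀ u : List Bool, u ≠ [] → u.length ≤ n + 1 → (Sum.inr (φ u) : ι ⊕ ℕ) ∉ Z.support) := by
  have hsplit : ∀ v : List Bool, v.length = n + 1 → ∃ c w, v = c :: w ∧ w.length = n := by
    intro v hv
    match v, hv with
    | c :: w, hv => exact ⟨c, w, rfl, by simpa using hv⟩
  have hinj4 : ∀ (u : List Bool) (c c' : Bool), φ (c :: u) = φ (c' :: u) → c = c' := by
    intro u c c' h
    rcases c with _ | _ <;> rcases c' with _ | _
    · rfl
    · exact absurd h (H4 u)
    · exact absurd h.symm (H4 u)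
    · rfl
  -- (A1) new entry point vs processed entry point
  have hA1 : ∀ (c : Bool) (w z : List Bool), w.length = n → z ≠ [] → z.length ≤ n →
      φ (c :: w) ≠ φ z := by
    intro c w z hw hz hzn heq
    obtain ⟨cz, z', rfl⟩ := List.exists_cons_of_ne_nil hz
    have hz'n : z'.length ≤ n := by simp at hzn; omega
    have hz'w : z' ≠ w := by rintro rfl; simp at hzn; omega
    have hwne : w ≠ [] := by
      rintro rfl
      simp at hw hzn; omega
    exact collision_point_old hG H1 H2 H5 hZ H6 hS8 hexp hr hIR hw.le hz'n hz'w hwne c cz heq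
  -- entry points injective up to level `n + 1`
  have hIP' : ∀ u u' : List Bool, u ≠ [] → u' ≠ [] → u.length ≤ n + 1 → u'.length ≤ n + 1 →
      φ u = φ u' → u = u' := by
    intro u u' hu hu' hun hu'n heq
    rcases Nat.lt_or_ge u.length (n + 1) with hul | hul
    · rcases Nat.lt_or_ge u'.length (n + 1) with hu'l | hu'l
      · exact hIP u u' hu hu' (by omega) (by omega) heq
      · obtain ⟨c', w', rfl, hw'⟩ := hsplit u' (le_antisymm hu'n hu'l)
        exact absurd heq.symm (hA1 c' w' u hw' hu (by omega))
    · obtain ⟨c, w, rfl, hw⟩ := hsplit u (le_antisymm hun hul)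
      rcases Nat.lt_or_ge u'.length (n + 1) with hu'l | hu'l
      · exact absurd heq (hA1 c w u' hw hu' (by omega))
      · obtain ⟨c', w', rfl, hw'⟩ := hsplit u' (le_antisymm hu'n hu'l)
        by_cases hww : w = w'
        · subst hww
          rw [hinj4 w c c' heq]
        · exact absurd heq fun h =>
            collision_point_new hG H1 H2 H5 hZ H6 hS8 hexp hr hIR hw.le hw'.le hww c c' h
  -- entry points off `Z` up to level `n + 1`
  have hAP' : ∀ u : List Bool, u ≠ [] → u.length ≤ n + 1 →
      (Sum.inr (φ u) : ι ⊕ ℕ) ∉ Z.support := by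
    intro u hu hun hmem
    rcases Nat.lt_or_ge u.length (n + 1) with hul | hul
    · exact hAP u hu (by omega) hmem
    · obtain ⟨c, w, rfl, hw⟩ := hsplit u (le_antisymm hun hul)
      exact collision_pointZ hG H1 H2 H5 hZ H6 hS8 hexp hr hIR hw.le c hmem
  -- rows off `Z` up to level `n + 1`
  have hAR' : ∀ u : List Bool, u ≠ [] → u.length ≤ n + 1 →
      (Sum.inl (ρ u) : ι ⊕ ℕ) ∉ Z.support := by
    intro u hu hun hmem
    rcases Nat.lt_or_ge u.length (n + 1) with hul | hul
    · exact hAR u hu (by omega) hmem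
    · obtain ⟨c, w, rfl, hw⟩ := hsplit u (le_antisymm hun hul)
      exact collision_rowZ hG H1 H2 H3 H5 hZ H6 hS8 hexp hr hIR hw.le c hmem
        (hAP' (c :: w) (List.cons_ne_nil c w) (by simp [hw]))
  -- (B1) new row vs processed row
  have hB1 : ∀ (c : Bool) (w z : List Bool), w.length = n → z.length ≤ n → ρ (c :: w) ≠ ρ z := by
    intro c w z hw hzn heq
    have hzne : z ≠ [] := by
      rintro rfl
      exact hAR' (c :: w) (List.cons_ne_nil c w) (by simp [hw]) (by rw [heq]; exact Z.start_mem_support)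
    have hzw : z ≠ w := by rintro rfl; exact H3 c z heq
    exact collision_row_old hG H1 H2 H5 hZ H6 hS8 hexp hr hIR hw.le hzn hzne hzw c heq
      (hA1 c w z hw hzne hzn)
  -- rows injective up to level `n + 1`
  have hIR' : ∀ u u' : List Bool, u.length ≤ n + 1 → u'.length ≤ n + 1 → ρ u = ρ u' →
      u = u' := by
    intro u u' hun hu'n heq
    rcases Nat.lt_or_ge u.length (n + 1) with hul | hul
    · rcases Nat.lt_or_ge u'.length (n + 1) with hu'l | hu'l
      · exact hIR u u' (by omega) (by omega) heq
      · obtain ⟨c', w', rfl, hw'⟩ := hsplit u' (le_antisymm hu'n hu'l)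
        exact absurd heq.symm (hB1 c' w' u hw' (by omega))
    · obtain ⟨c, w, rfl, hw⟩ := hsplit u (le_antisymm hun hul)
      rcases Nat.lt_or_ge u'.length (n + 1) with hu'l | hu'l
      · exact absurd heq (hB1 c w u' hw (by omega))
      · obtain ⟨c', w', rfl, hw'⟩ := hsplit u' (le_antisymm hu'n hu'l)
        by_contra hne
        have hyy : φ (c :: w) ≠ φ (c' :: w') := fun h =>
          hne (hIP' _ _ (List.cons_ne_nil c w) (List.cons_ne_nil c' w') (by simp [hw])
            (by simp [hw']) h)
        exact collision_row_new hG H1 H2 H3 H5 hZ H6 hS8 hexp hr hIR hw.le hw'.le c c' heq hyy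
          (hAP' (c :: w) (List.cons_ne_nil c w) (by simp [hw]))
  exact ⟨hIR', hIP', hAR', hAP'⟩

include H4 in
/-- **Phase two.** For a tree grown from a row of the cycle `Z` through points off `Z`, the row
labels are injective on all nodes of length `≤ N` whenever `|Z| + 4N + 6 ≤ r`. [folklore] -/
theorem phaseTwo (N : ℕ) (hr : ((Z.length + 4 * N + 6 : ℕ) : ℝ) ≤ r) :
    ∀ u u' : List Bool, u.length ≤ N → u'.length ≤ N → ρ u = ρ u' → u = u' := by
  suffices h : ∀ n ≤ N,
      (∀ u u' : List Bool, u.length ≤ n → u'.length ≤ n → ρ u = ρ u' → u = u') ∧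
      (∀ u u' : List Bool, u ≠ [] → u' ≠ [] → u.length ≤ n → u'.length ≤ n →
        φ u = φ u' → u = u') ∧
      (∀ u : List Bool, u ≠ [] → u.length ≤ n → (Sum.inl (ρ u) : ι ⊕ ℕ) ∉ Z.support) ∧
      (∀ u : List Bool, u ≠ [] → u.length ≤ n → (Sum.inr (φ u) : ι ⊕ ℕ) ∉ Z.support) from
    (h N le_rfl).1
  intro n hn
  induction n with
  | zero =>
    refine ⟨fun u u' hu hu' _ => ?_, fun u u' hu _ hun _ _ => ?_, fun u hu hun => ?_,
      fun u hu hun => ?_⟩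
    · rw [List.eq_nil_of_length_eq_zero (Nat.le_zero.1 hu),
        List.eq_nil_of_length_eq_zero (Nat.le_zero.1 hu')]
    · exact absurd (List.eq_nil_of_length_eq_zero (Nat.le_zero.1 hun)) hu
    · exact absurd (List.eq_nil_of_length_eq_zero (Nat.le_zero.1 hun)) hu
    · exact absurd (List.eq_nil_of_length_eq_zero (Nat.le_zero.1 hun)) hu
  | succ n ih =>
    obtain ⟨hIR, hIP, hAR, hAP⟩ := ih (Nat.le_of_succ_le hn)
    have hr' : ((Z.length + 4 * n + 10 : ℕ) : ℝ) ≤ r :=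
      le_trans (by exact_mod_cast (by omega : Z.length + 4 * n + 10 ≤ Z.length + 4 * N + 6)) hr
    exact phaseTwo_step hG H1 H2 H3 H4 H5 hZ H6 hS8 hexp hr' hIR hIP hAR hAP

end PhaseTwo

end MooreBound

end Summit.PneNP.PneNP.Theorems
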